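import Literature.MathematicalPhysics.QuantumFieldTheory.Balaban1983to89.B4Lemma24ZeroBoxScale

/-!
# `Balaban1983to89.B4Lemma24ZeroBoxAlphaNeg` — B4 Lemma 2.4 AS TYPED (`B4.Lemma24Printed`): the literal Hölder range
«α<1» of the typed leaf FAILS on the zero-field box family of `B4Lemma24ZeroBoxScale` — a kernel refutation of the
typed (2.36) clause for EVERY `α < 0` (hypothesis-free), hence `¬ B4.Lemma24Printed (zeroFieldScales …)`, and with
node 21 the Hölder-range dichotomy «`0 ≤ α < 1` HOLDS ∧ `α < 1` verbatim FAILS» for Lemma 2.4 (a leaf importing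
`B4Lemma24ZeroBoxScale` only; no existing module is touched; nothing of B4 is asserted)

Source under audit (cell pub-balaban): T. Bałaban, *Regularity and decay of lattice Green's functions*, Commun. Math.
Phys. **89** (1983) 571–597 [`Balaban1983RegularityDecay`, "B4"], p. 582 [PDF 12] Lemma 2.4 (2.35)–(2.37), p. 577
[PDF 7] the Hölder norms (2.14), p. 586 [PDF 16] (2.51) (journal page = PDF page + 570; renders
`b2b-balaban-ref1/pages/1983-cmp89-regularity-decay/1983-cmp89-regularity-decay-p012-x2.png`, `-p007-x2.png`,
`-p016-x2.png`, read as images).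

## WHAT IS PRINTED (verbatim; `≦` of the print written `≤`)

p. 582: «Lemma 2.4. There exist positive constants c₀, δ₀, and for α<1, there exists a constant c₁, such that
|(G_j(□)Q_j^*)(x, y)|, |(∂_μ^{L^{−j}} G_j(□)Q_j^*)(x, y)| ≤ c₀e^{−δ₀|x−y|},   (2.35)
(1/|x−x′|^α) |(∂_μ^{L^{−j}} G_j(□)Q_j^*)(x, y) − (∂_μ^{L^{−j}} G_j(□)Q_j^*)(x′, y)| ≤ c₁e^{−δ₀ dist({x,x′},y)},   (2.36)
|C^{(j)}(□; y, y′)| ≤ c₀e^{−δ₀|y−y′|},   (2.37)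
for arbitrary non-negative integer j, arbitrary, rectangular parallelepiped □ ⊂ L^{−j}Z^d built of large blocks, and
x, x′ ∈ □, y, y′ ∈ □^{(j)} = □∩Z^d.»

p. 577: «We will need Hölder norms:
‖f‖_{1,α} = max{sup_x |f(x)|, sup_{x,μ} |(D^η_{A,μ}f)(x)|, sup_{x,x′,μ} (1/|x′ − x|^α)|U(A(Γ_{x,x′}))·(D^η_{A,μ}f)(x′) −
(D^η_{A,μ}f)(x)|},   (2.14)  where the suprema are taken on a domain of the function f.»

p. 586 (end of the proof of Lemma 2.4): «≤ O(1), the constant depends on α<1.   (2.51)».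

## THE TYPED LEAF (tree, `B4.lean`; verbatim) AND ITS TWO HALVES (node 21)

`B4.Lemma24Printed (fam : I → B4.ScaleSetting) : Prop := ∃ c₀ δ₀ : ℝ, 0 < c₀ ∧ 0 < δ₀ ∧ (∀ i : I, (fam i).rectLarge →
(∀ x y, (fam i).kerGQ x y ≤ c₀ * Real.exp (-(δ₀ * (fam i).distF x y))) ∧ (∀ μ x y, (fam i).kerDGQ μ x y ≤ c₀ * Real.exp
(-(δ₀ * (fam i).distF x y))) ∧ (∀ y y', (fam i).kerC y y' ≤ c₀ * Real.exp (-(δ₀ * (fam i).distU y y')))) ∧ (∀ α : ℝ,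
α < 1 → ∃ c₁ : ℝ, 0 < c₁ ∧ ∀ i : I, (fam i).rectLarge → ∀ μ x x' y, (fam i).lhs236 α μ x x' y ≤ c₁ * Real.exp (-(δ₀ *
(fam i).dist2F x x' y)))` — the second conjunct carries the LITERAL binder `∀ α : ℝ, α < 1 →` with NO lower bound on
`α`.  Node 21 (`B4Lemma24ZeroBoxScale`) names its halves `Bounds235and237 fam c₀ δ₀` and `Bound236 fam δ₀ α`
(`lemma24Printed_iff` is `Iff.rfl`), builds the zero-field box family `zeroFieldScales d ℓ a₋ a₊ m²₊ a₂₋ a₂₊ :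
ScaleIdx … → B4.ScaleSetting` (every mesh `n ≥ 1`, every box of `L`-blocks, constants in the window) and proves the
leaf WITH `0 ≤ α →` INSERTED, `lemma24PrintedNN_zeroFieldScales`, recording (HONEST SCOPE (e) there) that the clause
with `α < 0` is neither claimed nor refuted.  This file refutes it.

## WHAT THIS FILE CERTIFIES (kernel-checked, zero `sorry`, no hypothesis; HONEST SCOPE below)

* §1 THE UNIT-MESH NEUMANN BOX GREEN FUNCTION `G = (−Δ^N_□ + m² + a)⁻¹` (`uG m2 a N =
  (B4BoxCov237.opBoxR 1 m2 a 1 N)⁻¹`; at mesh `n = 1` b04's `boxOpR 1 a m2 M` IS this operator, `boxOpR_one`, since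
  every block is a point, `boxBlk_one`):
  the operator is a Z-matrix with row sums `m² + a` (`unitOp_mulVec`), whence the DISCRETE MINIMUM PRINCIPLE
  (`nonneg_of_unitOp_mulVec_nonneg`), `G ≥ 0` (`green_nonneg`), the TOTAL MASS `(m²+a)Σ_z G(z,x₀) = 1` (`green_mass`),
  `(2(d+1)+m²+a)·G(x₀,x₀) ≥ 1`, `(2(d+1)+m²+a)·G(y₁,x₀) ≥ G(x₀,x₀)` for `y₁ ∼ x₀` (`green_diag_lower`,
  `green_nbr_lower`), and the BOX-INDEPENDENT GAP: at any box point `x₀` with a neighbour in the box, some neighbour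
  `y ∼ x₀` has `G(x₀,x₀) − G(y,x₀) ≥ c_*(d, m²+a) = s/((2(d+1)+s)²·2(d+1))`, `s = m² + a` (`green_gap`, `cstar`).
* §2 a telescoping pigeonhole (`exists_step_ge`): a sequence with `0 ≤ f ≤ B` has, among any `K ≥ B/c` consecutive
  steps, one step `f(t+1) − f(t) ≥ −c`.
* §3 THE REFUTING MEMBERS `cornerIdx … N′` of node 21's index window: mesh `n = 1`, `a_j = a₋`, `m_j² = 0`, `a = a₂₋`,
  the cube of `N′` `L`-blocks per side; and THE VALUE OF THE TYPED (2.36) QUANTITY at direction `μ`, base point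
  `x = 0` (a corner), far point `x′ = t·e_μ` (`t ≥ 1`), unit point `y = 0`: `lhs236 α μ x x′ y = (1/t)^α·|(G(x′+e_μ,0) −
  G(x′,0)) − (G(e_μ,0) − G(0,0))|` (`member_lhs236`; `G = uG 0 a₋ □`, via b04's `boxOp_inv_eq_map`: the complex box
  propagator's entries are the real ones) and `dist2F x x′ y = 0` (`member_dist2F`).
* §4 **`not_bound236_zeroFieldScales`**: for every `d`, `ℓ`, every window `0 < a₋ ≤ a₊`, `m²₊ ≥ 0`, `a₂₋ ≤ a₂₊`, every
  `α < 0` and EVERY `δ₀ ∈ ℝ`: `¬ Bound236 (zeroFieldScales d ℓ a₋ a₊ m²₊ a₂₋ a₂₊) δ₀ α` — given `c₁ > 0`, take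
  `T = ⌈(4c₁/c_*)^{1/(−α)}⌉ + 1`, `K = ⌈(2/a₋)/c_*⌉ + 1`, `N′ ≥ T + K + 1`; the corner gap gives a direction `μ` with
  `G(e_μ,0) − G(0,0) ≤ −c_*`, the pigeonhole a `t ∈ [T, T+K)` with `G((t+1)e_μ,0) − G(te_μ,0) ≥ −c_*/2` (the column is
  bounded by `1/a₋`), so the bracket is `≥ c_*/2` while the weight is `(1/t)^α = t^{−α} ≥ 4c₁/c_*`: left side `≥ 2c₁`,
  right side `= c₁·e^0 = c₁`.  Hence **`not_lemma24Printed_zeroFieldScales : ¬ B4.Lemma24Printed (zeroFieldScales d ℓ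
  a₋ a₊ m²₊ a₂₋ a₂₊)`** (instance `α = −1` of the second conjunct), the DICHOTOMY
  `holderRange_dichotomy_zeroFieldScales : Lemma24PrintedNN (zeroFieldScales …) ∧ ¬ B4.Lemma24Printed
  (zeroFieldScales …)` (`ℓ ≥ 1`, `a₂₋ > 0`, with node 21),
  and `not_lemma24Printed_of_NN` (the converse of node 21's `lemma24PrintedNN_of_printed` is false on this family).
* §5 non-vacuity on node 21's concrete family `zeroFieldScales 3 1 (1/2) 2 1 (1/2) 2` (`d + 1 = 4`, `L = 2`; inhabited
  index type, `idx0`): the leaf fails, its `0 ≤ α < 1` restriction holds, and `Bound236 … 0 (−1/2)` fails.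

## HONEST SCOPE

(a) This is a statement about the TYPED TRANSCRIPTION `B4.Lemma24Printed`, not against B4's Lemma 2.4 as its proof
reads it: the print's «for α<1» names the exponent of the HÖLDER norm (2.14) (p. 577), and B4 PRINTS NO LOWER BOUND
for `α` anywhere (only «α<1»: p. 573 Theorem, p. 577 (2.14), p. 582 Lemma 2.4, p. 586 (2.51)); `0 ≤ α` is used TACITLY
in the proof (p. 582, the first term of (2.39); p. 585, the last display
`(1/|x−x′|^α)|e^{i(p′+l)·(x−x′)} − 1| ≦ O(1)|p′+l|^α`, which fails for `α < 0`), and `α < 1` is what makes the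
geometric sums `Σ_j (L^jη)^{1−α}` of (2.39) and the bound (2.51) converge. For `α < 0` the weight
`1/|x − x′|^α = |x − x′|^{|α|}` GROWS with the separation and (2.36) is no regularity statement; read literally, with
`c₁` independent of the (arbitrary) box, it fails already for the free Neumann Green function of a large cube at zero
field, in every dimension, as certified here. The natural repair of the typed leaf — NOT made here (b04 owns
`B4.lean`) — is the binder pair `0 ≤ α → α < 1 →`, i.e. node 21's `Lemma24PrintedNN`, which node 21 discharges on
`zeroFieldScales`; with that tacit lower bound read into «for α<1» nothing printed is contradicted, without it the
printed sentence shares the defect of its faithful transcription. DOWNSTREAM (v1.1, corrected after the independent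
cross-read of this file by b2b-balaban-pv06-g24): the consumers `B5FromB4.prop12_of_B4` and
`B5Ineq110Gp.leafGp_of_lemma24` use the first conjunct only, BUT `B5Ineq113.h113_of_display136` destructures the leaf
and USES the (2.36) conjunct (`H236 α hα` for every `α < 1` ↦ `leaf236_of_lemma24` ↦ `Leaf236` ↦
`ineq113At_of_display136`), consuming it only at `0 ≤ α < 1` (`hα0` in scope there); so the repair `0 ≤ α →` is
compatible with every consumer but is not a one-token change (`B5Ineq113` must be co-patched — b04's and b05's call),
and, as typed today, every chain theorem with a binder `h24 : B4.Lemma24Printed fam₂₄` is uninstantiable with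
`fam₂₄ :=` node 21's family (this file; every fixed-mesh slice: node 23 `B4Lemma24ZeroBoxAlphaNegMesh`).
(b) The refuting members are the MESH-1 members of node 21's family (`n = 1 = L⁰`: the print's «arbitrary
non-negative integer j» at `j = 0`; node 21's family contains every `n ≥ 1`, HONEST SCOPE (d) there), with `m_j² = 0`,
`a_j = a₋`, on cubes of `N′` `L`-blocks; at mesh 1 every block is a single point, so `−Δ^ξ + m_j² + a_jQ_j^*Q_j`
((2.44)) is the Z-matrix `−Δ^N_□ + a₋` and the elementary minimum principle of §1 applies.  For meshes `n ≥ 2` the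
same divergence of the weight is expected but is NOT certified here (the block-averaging term has positive
off-diagonal entries and §1 does not apply verbatim).
(c) Conventions are node 21's (HONEST SCOPE (b), (c) there): sup norms, `A = 0`, one component, Neumann boxes anchored
at the origin, the guard of `lhs236` (both forward neighbours in `□`, `x ≠ x′`) — the refuting configuration
satisfies the guard (`0 + e_μ`, `t·e_μ + e_μ ∈ □`, `t·e_μ ≠ 0`), so the certified value is the printed quantity, not the
conventional `0`.
(d) `δ₀` is arbitrary (any sign): the decay distance of the refuting configuration is `dist({x,x′},y) = |x − y| = 0`.
The positivity of `c₀` and the first conjunct play no role.  The constants `T, K, N′` depend on `c₁, α, d, a₋` (as they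
must); nothing is uniform in `α ↑ 0`.
(e) Value = kernel certificate of a TYPING DEFECT of the cell's leaf `B4.Lemma24Printed` (the literal Hölder range),
with an explicit zero-field counterexample and the matching dichotomy with node 21 — the Lemma-2.4 analogue of the
Theorem-(1.9) certificate `B4Thm19ZeroBoxNegAlpha` (b04's leaf `B4.ThmPrinted`; there the source is taken in the range
of the operator, here the kernel itself is bounded below through the minimum principle, since (2.36) has no test
function); negative knowledge for b04 / the carver; NOT summit progress and NOT a claim against B4.

## DICTIONARY (print ↦ Lean; node 21's, all at `A = 0`, one component, plus the unit-mesh objects of this file)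

`j = 0`, `ξ = 1` ↦ mesh `i.n = 1` (`cornerIdx`); `□` ↦ the cube `boxDom (fun _ ↦ 1·(L·N′))` of fine (= unit) points,
`□^{(0)}` ↦ `boxDom (fun _ ↦ L·N′)`; `G_j(□)` ↦ `(boxOp 1 a₋ 0 M)⁻¹ = ((boxOpR 1 a₋ 0 M)⁻¹).map (↑)` (b04) `= uG 0 a₋ □`
(`boxOpR_one`); `(G_j(□)Q_j^*)(x, y)` ↦ the block sum, at mesh 1 the single term `x″ = y` (`blk 1 z = z`, `blk_one`);
`∂^ξ_μ` ↦ the forward unit difference; `1/|x − x′|^α` ↦ `(1/|x′ − x|_∞)^α` (`Real.rpow`); `dist({x,x′},y)` ↦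
`min (fdist 1 x y) (fdist 1 x′ y)`; the rest as in `B4Lemma24ZeroBoxScale`.

DEPENDENCIES (kernel-proved tree modules only; no Literature fact is minted, no hypothesis is assumed): node 21
`B4Lemma24ZeroBoxScale` (`ScaleIdx`, `zeroFieldScales`, `Bound236`, `lemma24Printed_iff`, `Lemma24PrintedNN`,
`lemma24PrintedNN_zeroFieldScales`, `fdist`, `fdist_nonneg`, `idx0`), b04's `B4` (`Lemma24Printed`, `ScaleSetting`),
`B4BoxCov237` (`opBoxR`, `opBoxR_mulVec`, `opBoxR_isUnit`, `boxOpR`, `boxOp_inv_eq_map`, `sum_boxNbrs_commR`,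
`supNorm_zero'`), `B4Green242Bridge` (`boxOp`, `boxNbrs`, `boxBlk`, `card_boxNbrs`, `mem_boxNbrs_comm`,
`not_mem_boxNbrs_self`, `zero_mem_boxDom`), `B4Reflection242` (`boxDom`, `mem_boxDom`, `blk`, `nbrs`, `mem_nbrs`,
`card_nbrs`, `supNorm_le_of_forall`), `B4ContourShift` (`supNorm`, `abs_le_supNorm`); Mathlib otherwise.

PROVENANCE: this node (pv17 node 22); all proofs are this file's.  Axioms: `propext`, `Classical.choice`, `Quot.sound`
only. VERSIONS: v1 p191891 (commit cb150f8e09ae); v1.1 (this file) = DOCFIX after the independent cross-read by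
b2b-balaban-pv06-g24 («agree, items 7/7, DOCFIX 2»: D-1 LOW — no lower bound for `α` is printed, the tacit `0 ≤ α` is
now located (pp. 582/585) instead of attributed to (2.14), in HONEST SCOPE (a) and in the cite tag of
`holderRange_dichotomy_zeroFieldScales`; D-2 MED — the downstream use of the (2.36) conjunct in
`B5Ineq113.h113_of_display136` is now recorded in HONEST SCOPE (a)); no declaration, statement or proof changed (one
docstring sentence and the header only).
-/

namespace Literature.MathematicalPhysics.QuantumFieldTheory.Balaban1983to89.B4Lemma24ZeroBoxAlphaNeg

open Finset Matrix
open Literature.MathematicalPhysics.QuantumFieldTheory.Balaban1983to89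
open Literature.MathematicalPhysics.QuantumFieldTheory.Balaban1983to89.B4ContourShift
open Literature.MathematicalPhysics.QuantumFieldTheory.Balaban1983to89.B4Reflection242
open Literature.MathematicalPhysics.QuantumFieldTheory.Balaban1983to89.B4Green242Bridge
open Literature.MathematicalPhysics.QuantumFieldTheory.Balaban1983to89.B4BoxCov237
open Literature.MathematicalPhysics.QuantumFieldTheory.Balaban1983to89.B4Lemma24ZeroBoxScale

noncomputable section

variable {d : ℕ}

/-! ## §1  The unit-mesh Neumann box operator `−Δ^N_□ + m² + a` and its Green function: minimum principle,
total mass, and a box-independent gap at a point with a neighbour -/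

/-- at mesh `n = 1` every site is its own block: `blk 1 z = z`. [folklore] -/
theorem blk_one (z : Fin (d + 1) → ℤ) : blk 1 z = z := by
  funext i
  simp [blk]

/-- at mesh `n = 1` the block of a box point is the point. [folklore] -/
theorem boxBlk_one (N : Fin (d + 1) → ℕ) (x : ↥(boxDom N)) : boxBlk 1 N x = {x} := by
  ext y
  simp only [boxBlk, Finset.mem_filter, Finset.mem_univ, true_and, Finset.mem_singleton, blk_one]
  exact ⟨fun h => Subtype.ext h, fun h => h ▸ rfl⟩

/-- the unit-mesh Green function `G = (−Δ^N_□ + m² + a)⁻¹` of the box `Π_μ[0,N_μ)` (real matrix;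
`B4BoxCov237.opBoxR 1 m2 a 1 N` is b04's `boxOpR 1 a m2 ·` up to the trivial coefficients `1² = 1`,
`a·1^{-(d+1)} = a`, see `boxOpR_one`). [folklore] -/
abbrev uG (m2 a : ℝ) (N : Fin (d + 1) → ℕ) : Matrix ↥(boxDom N) ↥(boxDom N) ℝ := (opBoxR 1 m2 a 1 N)⁻¹

/-- b04's real box operator at mesh `1` is the unit-mesh operator. [folklore] -/
theorem boxOpR_one (a m2 : ℝ) (M : Fin (d + 1) → ℕ) : boxOpR 1 a m2 M = opBoxR 1 m2 a 1 (fun i => 1 * M i) := by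
  simp [boxOpR]

/-- the unit-mesh operator on a vector: `(Av)(x) = Σ_{y ∈ □, y ∼ x}(v x − v y) + (m² + a)·v x` — a Z-matrix with
constant positive row sum `m² + a`. [folklore] -/
theorem unitOp_mulVec (m2 a : ℝ) (N : Fin (d + 1) → ℕ) (v : ↥(boxDom N) → ℝ) (x : ↥(boxDom N)) :
    (opBoxR 1 m2 a 1 N).mulVec v x = (∑ y ∈ boxNbrs N x, (v x - v y)) + (m2 + a) * v x := by
  rw [opBoxR_mulVec, boxBlk_one, Finset.sum_singleton]
  ring

/-- **DISCRETE MINIMUM PRINCIPLE** for the unit-mesh operator (`m² + a > 0`): `Av ≥ 0` entrywise forces `v ≥ 0`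
(at a minimum point every bond term `v x − v y` is `≤ 0`, so `(Av)(x) ≤ (m²+a)·v x`). [folklore] -/
theorem nonneg_of_unitOp_mulVec_nonneg {m2 a : ℝ} (hs : 0 < m2 + a) (N : Fin (d + 1) → ℕ)
    (v : ↥(boxDom N) → ℝ) (h : ∀ x, 0 ≤ (opBoxR 1 m2 a 1 N).mulVec v x) : ∀ x, 0 ≤ v x := by
  classical
  by_contra hneg
  push Not at hneg
  obtain ⟨x₁, hx₁⟩ := hneg
  obtain ⟨x₀, -, hmin⟩ := Finset.exists_min_image Finset.univ v ⟨x₁, Finset.mem_univ _⟩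
  have hx₀ : v x₀ < 0 := lt_of_le_of_lt (hmin x₁ (Finset.mem_univ _)) hx₁
  have hrow := h x₀
  rw [unitOp_mulVec] at hrow
  have hsum : ∑ y ∈ boxNbrs N x₀, (v x₀ - v y) ≤ 0 :=
    Finset.sum_nonpos fun y _ => sub_nonpos.2 (hmin y (Finset.mem_univ _))
  have hneg' : (m2 + a) * v x₀ < 0 := mul_neg_of_pos_of_neg hs hx₀
  linarith

/-- the unit-mesh operator is invertible, `A·A⁻¹ = 1` (`m² ≥ 0`, `a > 0`, `N_μ ≥ 1`; b04's `opBoxR_isUnit`).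
[folklore] -/
theorem unitOp_mul_inv {m2 a : ℝ} (hm : 0 ≤ m2) (ha : 0 < a) {N : Fin (d + 1) → ℕ} (hN : ∀ i, 1 ≤ N i) :
    opBoxR 1 m2 a 1 N * uG m2 a N = 1 :=
  Matrix.mul_nonsing_inv _ ((Matrix.isUnit_iff_isUnit_det _).1 (opBoxR_isUnit one_pos hm ha 1 hN))

/-- the column `G(·, x₀)` of the Green function solves `A G(·,x₀) = δ_{x₀}`. [folklore] -/
theorem green_col {m2 a : ℝ} (hm : 0 ≤ m2) (ha : 0 < a) {N : Fin (d + 1) → ℕ} (hN : ∀ i, 1 ≤ N i)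
    (x₀ z : ↥(boxDom N)) :
    (opBoxR 1 m2 a 1 N).mulVec (fun y => uG m2 a N y x₀) z = if z = x₀ then 1 else 0 := by
  have h := congr_fun (congr_fun (unitOp_mul_inv hm ha hN) z) x₀
  rw [Matrix.mul_apply, Matrix.one_apply] at h
  simpa [Matrix.mulVec, dotProduct] using h

/-- the row identity of the Green column at a point `z`:
`Σ_{y ∼ z}(G(z,x₀) − G(y,x₀)) + (m²+a)·G(z,x₀) = δ_{z x₀}`. [folklore] -/
theorem green_row {m2 a : ℝ} (hm : 0 ≤ m2) (ha : 0 < a) {N : Fin (d + 1) → ℕ} (hN : ∀ i, 1 ≤ N i)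
    (x₀ z : ↥(boxDom N)) :
    (∑ y ∈ boxNbrs N z, (uG m2 a N z x₀ - uG m2 a N y x₀)) + (m2 + a) * uG m2 a N z x₀
      = if z = x₀ then 1 else 0 := by
  rw [← unitOp_mulVec m2 a N (fun y => uG m2 a N y x₀) z]
  exact green_col hm ha hN x₀ z

/-- **POSITIVITY OF THE NEUMANN BOX GREEN FUNCTION** at mesh `1`: `G(z, x₀) ≥ 0` (minimum principle). [folklore] -/
theorem green_nonneg {m2 a : ℝ} (hm : 0 ≤ m2) (ha : 0 < a) {N : Fin (d + 1) → ℕ} (hN : ∀ i, 1 ≤ N i)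
    (x₀ z : ↥(boxDom N)) : 0 ≤ uG m2 a N z x₀ :=
  nonneg_of_unitOp_mulVec_nonneg (m2 := m2) (a := a) (by linarith) N (fun y => uG m2 a N y x₀)
    (fun x => by rw [green_col hm ha hN x₀ x]; split_ifs <;> norm_num) z

/-- **TOTAL MASS**: `(m² + a)·Σ_z G(z, x₀) = 1` (sum of all row identities; the bond terms cancel in pairs).
[folklore] -/
theorem green_mass {m2 a : ℝ} (hm : 0 ≤ m2) (ha : 0 < a) {N : Fin (d + 1) → ℕ} (hN : ∀ i, 1 ≤ N i)
    (x₀ : ↥(boxDom N)) : (m2 + a) * ∑ z, uG m2 a N z x₀ = 1 := by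
  classical
  have hrows : ∑ z, ((∑ y ∈ boxNbrs N z, (uG m2 a N z x₀ - uG m2 a N y x₀)) + (m2 + a) * uG m2 a N z x₀)
      = ∑ z : ↥(boxDom N), (if z = x₀ then (1 : ℝ) else 0) :=
    Finset.sum_congr rfl fun z _ => green_row hm ha hN x₀ z
  rw [Finset.sum_ite_eq' Finset.univ x₀, if_pos (Finset.mem_univ _), Finset.sum_add_distrib,
    ← Finset.mul_sum] at hrows
  have hlap : ∑ z, ∑ y ∈ boxNbrs N z, (uG m2 a N z x₀ - uG m2 a N y x₀) = 0 := by
    simp only [Finset.sum_sub_distrib]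
    rw [sum_boxNbrs_commR (fun z _ => uG m2 a N z x₀), sub_self]
  linarith

/-- the in-box degree is at most `2(d+1)`. [folklore] -/
theorem card_boxNbrs_le_real (N : Fin (d + 1) → ℕ) (x : ↥(boxDom N)) :
    ((boxNbrs N x).card : ℝ) ≤ 2 * (d + 1) := by
  have h : (boxNbrs N x).card ≤ 2 * (d + 1) := by
    rw [card_boxNbrs, ← card_nbrs x.1]
    exact Finset.card_filter_le _ _
  exact_mod_cast h

/-- the bond sum at `z` expands as `k_z·G(z,x₀) − Σ_{y∼z} G(y,x₀)` with `k_z` the in-box degree. [folklore] -/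
theorem green_bond_sum (m2 a : ℝ) (N : Fin (d + 1) → ℕ) (x₀ z : ↥(boxDom N)) :
    ∑ y ∈ boxNbrs N z, (uG m2 a N z x₀ - uG m2 a N y x₀)
      = (boxNbrs N z).card * uG m2 a N z x₀ - ∑ y ∈ boxNbrs N z, uG m2 a N y x₀ := by
  rw [Finset.sum_sub_distrib, Finset.sum_const, nsmul_eq_mul]

/-- **THE DIAGONAL IS NOT SMALL**: `(2(d+1) + m² + a)·G(x₀,x₀) ≥ 1` (row identity at `x₀`, positivity). [folklore] -/
theorem green_diag_lower {m2 a : ℝ} (hm : 0 ≤ m2) (ha : 0 < a) {N : Fin (d + 1) → ℕ} (hN : ∀ i, 1 ≤ N i)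
    (x₀ : ↥(boxDom N)) : 1 ≤ (2 * (d + 1) + (m2 + a)) * uG m2 a N x₀ x₀ := by
  have hrow := green_row hm ha hN x₀ x₀
  rw [if_pos rfl, green_bond_sum] at hrow
  have h1 : 0 ≤ ∑ y ∈ boxNbrs N x₀, uG m2 a N y x₀ := Finset.sum_nonneg fun y _ => green_nonneg hm ha hN x₀ y
  have h2 : ((boxNbrs N x₀).card : ℝ) * uG m2 a N x₀ x₀ ≤ 2 * (d + 1) * uG m2 a N x₀ x₀ :=
    mul_le_mul_of_nonneg_right (card_boxNbrs_le_real N x₀) (green_nonneg hm ha hN x₀ x₀)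
  nlinarith

/-- **A NEIGHBOUR IS NOT SMALL**: for `y₁ ∼ x₀`, `(2(d+1) + m² + a)·G(y₁,x₀) ≥ G(x₀,x₀)` (row identity at `y₁`,
positivity). [folklore] -/
theorem green_nbr_lower {m2 a : ℝ} (hm : 0 ≤ m2) (ha : 0 < a) {N : Fin (d + 1) → ℕ} (hN : ∀ i, 1 ≤ N i)
    (x₀ : ↥(boxDom N)) {y₁ : ↥(boxDom N)} (hy₁ : y₁ ∈ boxNbrs N x₀) :
    uG m2 a N x₀ x₀ ≤ (2 * (d + 1) + (m2 + a)) * uG m2 a N y₁ x₀ := by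
  classical
  have hne : y₁ ≠ x₀ := fun h => not_mem_boxNbrs_self x₀ (h ▸ hy₁)
  have hrow := green_row hm ha hN x₀ y₁
  rw [if_neg hne, green_bond_sum] at hrow
  have hx₀ : x₀ ∈ boxNbrs N y₁ := mem_boxNbrs_comm.1 hy₁
  have h1 : uG m2 a N x₀ x₀ ≤ ∑ y ∈ boxNbrs N y₁, uG m2 a N y x₀ :=
    Finset.single_le_sum (fun y _ => green_nonneg hm ha hN x₀ y) hx₀
  have h2 : ((boxNbrs N y₁).card : ℝ) * uG m2 a N y₁ x₀ ≤ 2 * (d + 1) * uG m2 a N y₁ x₀ :=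
    mul_le_mul_of_nonneg_right (card_boxNbrs_le_real N y₁) (green_nonneg hm ha hN x₀ y₁)
  nlinarith

/-- two distinct entries of a column carry at most the total mass: `(m²+a)(G(x₀,x₀) + G(y₁,x₀)) ≤ 1`. [folklore] -/
theorem green_two_le_one {m2 a : ℝ} (hm : 0 ≤ m2) (ha : 0 < a) {N : Fin (d + 1) → ℕ} (hN : ∀ i, 1 ≤ N i)
    (x₀ : ↥(boxDom N)) {y₁ : ↥(boxDom N)} (hne : y₁ ≠ x₀) :
    (m2 + a) * (uG m2 a N x₀ x₀ + uG m2 a N y₁ x₀) ≤ 1 := by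
  classical
  have hmass := green_mass hm ha hN x₀
  have hsub : ({x₀, y₁} : Finset ↥(boxDom N)) ⊆ Finset.univ := Finset.subset_univ _
  have hpair : ∑ z ∈ ({x₀, y₁} : Finset ↥(boxDom N)), uG m2 a N z x₀ = uG m2 a N x₀ x₀ + uG m2 a N y₁ x₀ :=
    Finset.sum_pair (Ne.symm hne)
  have hle : ∑ z ∈ ({x₀, y₁} : Finset ↥(boxDom N)), uG m2 a N z x₀ ≤ ∑ z, uG m2 a N z x₀ :=
    Finset.sum_le_sum_of_subset_of_nonneg hsub fun z _ _ => green_nonneg hm ha hN x₀ z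
  have hs : 0 < m2 + a := by linarith
  rw [hpair] at hle
  nlinarith

/-- a column entry is at most the total mass: `(m²+a)·G(z,x₀) ≤ 1`. [folklore] -/
theorem green_le_one {m2 a : ℝ} (hm : 0 ≤ m2) (ha : 0 < a) {N : Fin (d + 1) → ℕ} (hN : ∀ i, 1 ≤ N i)
    (x₀ z : ↥(boxDom N)) : (m2 + a) * uG m2 a N z x₀ ≤ 1 := by
  classical
  have hmass := green_mass hm ha hN x₀
  have hle : uG m2 a N z x₀ ≤ ∑ w, uG m2 a N w x₀ :=
    Finset.single_le_sum (fun w _ => green_nonneg hm ha hN x₀ w) (Finset.mem_univ z)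
  have hs : 0 < m2 + a := by linarith
  nlinarith

/-- the box-independent gap constant `c_*(d, s) = s / ((2(d+1) + s)²·2(d+1))`, `s = m² + a`. [folklore] -/
def cstar (d : ℕ) (s : ℝ) : ℝ := s / ((2 * (d + 1) + s) ^ 2 * (2 * (d + 1)))

/-- `c_* > 0` for `s > 0`. [folklore] -/
theorem cstar_pos (d : ℕ) {s : ℝ} (hs : 0 < s) : 0 < cstar d s := by
  unfold cstar
  positivity

/-- **THE BOX-INDEPENDENT GAP**: at a box point `x₀` with at least one neighbour inside the box, some neighbour `y ∼ x₀`
has `G(x₀,x₀) − G(y,x₀) ≥ c_*(d, m²+a) > 0`, uniformly in the box (row identity at `x₀`: the bond sum equals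
`1 − (m²+a)G(x₀,x₀) ≥ (m²+a)G(y₁,x₀) ≥ (m²+a)/(2(d+1)+m²+a)²` by the total mass and the two lower bounds; then
average over the at most `2(d+1)` bonds). [folklore] -/
theorem green_gap {m2 a : ℝ} (hm : 0 ≤ m2) (ha : 0 < a) {N : Fin (d + 1) → ℕ} (hN : ∀ i, 1 ≤ N i)
    (x₀ : ↥(boxDom N)) (hnb : (boxNbrs N x₀).Nonempty) :
    ∃ y ∈ boxNbrs N x₀, cstar d (m2 + a) ≤ uG m2 a N x₀ x₀ - uG m2 a N y x₀ := by
  classical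
  obtain ⟨y₁, hy₁⟩ := hnb
  have hne : y₁ ≠ x₀ := fun h => not_mem_boxNbrs_self x₀ (h ▸ hy₁)
  have hs : 0 < m2 + a := by linarith
  set s := m2 + a with hs_def
  set D : ℝ := 2 * (d + 1) with hD_def
  have hD : (1 : ℝ) ≤ D := by rw [hD_def]; have : (0 : ℝ) ≤ d := Nat.cast_nonneg d; linarith
  have hrow := green_row hm ha hN x₀ x₀
  rw [if_pos rfl] at hrow
  have hdiag := green_diag_lower hm ha hN x₀
  have hnbr := green_nbr_lower hm ha hN x₀ hy₁
  have htwo := green_two_le_one hm ha hN x₀ hne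
  -- the bond sum at x₀ is at least s/(D+s)²
  have hsum : s / (D + s) ^ 2 ≤ ∑ y ∈ boxNbrs N x₀, (uG m2 a N x₀ x₀ - uG m2 a N y x₀) := by
    have e1 : ∑ y ∈ boxNbrs N x₀, (uG m2 a N x₀ x₀ - uG m2 a N y x₀) = 1 - s * uG m2 a N x₀ x₀ := by
      rw [← hD_def] at hdiag; linarith
    rw [e1]
    have hDs : 0 < D + s := by linarith
    -- (D+s)·G(y₁,x₀) ≥ G(x₀,x₀) ≥ 1/(D+s)  ⇒  G(y₁,x₀) ≥ 1/(D+s)²; and 1 − s·G(x₀,x₀) ≥ s·G(y₁,x₀)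
    have h1 : 1 / (D + s) ≤ uG m2 a N x₀ x₀ := by
      rw [div_le_iff₀ hDs]; rw [← hD_def] at hdiag; linarith
    have h2 : 1 / (D + s) ^ 2 ≤ uG m2 a N y₁ x₀ := by
      rw [div_le_iff₀ (by positivity)]
      rw [← hD_def] at hnbr
      nlinarith
    have h3 : s * uG m2 a N y₁ x₀ ≤ 1 - s * uG m2 a N x₀ x₀ := by nlinarith
    calc s / (D + s) ^ 2 = s * (1 / (D + s) ^ 2) := by ring
      _ ≤ s * uG m2 a N y₁ x₀ := mul_le_mul_of_nonneg_left h2 hs.le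
      _ ≤ 1 - s * uG m2 a N x₀ x₀ := h3
  -- average over at most D bonds
  by_contra hcon
  push Not at hcon
  have hlt : ∑ y ∈ boxNbrs N x₀, (uG m2 a N x₀ x₀ - uG m2 a N y x₀) < ∑ y ∈ boxNbrs N x₀, cstar d (m2 + a) :=
    Finset.sum_lt_sum_of_nonempty ⟨y₁, hy₁⟩ fun y hy => hcon y hy
  rw [Finset.sum_const, nsmul_eq_mul] at hlt
  have hcard := card_boxNbrs_le_real N x₀
  have hcpos : 0 < cstar d (m2 + a) := cstar_pos d hs
  have hle : ((boxNbrs N x₀).card : ℝ) * cstar d (m2 + a) ≤ D * cstar d (m2 + a) :=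
    mul_le_mul_of_nonneg_right (by rw [hD_def]; exact hcard) hcpos.le
  have hDc : D * cstar d (m2 + a) = s / (D + s) ^ 2 := by
    rw [← hs_def]; unfold cstar; rw [← hD_def]
    field_simp
  linarith

/-! ## §2  A telescoping pigeonhole for bounded sequences -/

/-- if `0 ≤ f ≤ B` and `K·c ≥ B` (`K ≥ 1`, `c > 0`), then among any `K` consecutive steps `t = T, …, T+K−1` one has
`f(t+1) − f(t) ≥ −c` (else the steps telescope to `f(T+K) − f(T) < −K·c ≤ −B`). [folklore] -/
theorem exists_step_ge {f : ℕ → ℝ} {B c : ℝ} (hf0 : ∀ t, 0 ≤ f t) (hfB : ∀ t, f t ≤ B)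
    (T K : ℕ) (hK1 : 1 ≤ K) (hK : B ≤ K * c) : ∃ t, T ≤ t ∧ t < T + K ∧ -c ≤ f (t + 1) - f t := by
  by_contra h
  push Not at h
  have hlt : ∀ r ∈ Finset.range K, f (T + (r + 1)) - f (T + r) < -c := fun r hr =>
    h (T + r) (Nat.le_add_right _ _) (by have := Finset.mem_range.1 hr; omega)
  have hsum : ∑ r ∈ Finset.range K, (f (T + (r + 1)) - f (T + r)) < ∑ r ∈ Finset.range K, (-c) :=
    Finset.sum_lt_sum_of_nonempty (Finset.nonempty_range_iff.2 (by omega)) hlt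
  have htel : ∑ r ∈ Finset.range K, (f (T + (r + 1)) - f (T + r)) = f (T + K) - f (T + 0) :=
    Finset.sum_range_sub (fun r => f (T + r)) K
  rw [htel, Finset.sum_const, Finset.card_range, nsmul_eq_mul, Nat.add_zero] at hsum
  have h1 := hf0 (T + K)
  have h2 := hfB T
  linarith

/-! ## §3  The refuting members: unit-mesh cubes, source block and base point at the corner -/

section Member

variable {ℓ : ℕ} {aminus aplus m2plus a2minus a2plus : ℝ}

/-- THE REFUTING MEMBER of the index window: mesh `n = 1` (the printed «arbitrary non-negative integer j» at `j = 0`,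
`L^j η = 1`), `a_j = a₋`, `m_j² = 0`, `a = a₂₋`, the cube of `N′` `L`-blocks per side (fine = unit side `L·N′`).
[folklore] -/
def cornerIdx (d ℓ : ℕ) {aminus aplus m2plus a2minus a2plus : ℝ} (ha' : aminus ≤ aplus) (hm2 : 0 ≤ m2plus)
    (ha2 : a2minus ≤ a2plus) (N' : ℕ) (hN' : 1 ≤ N') : ScaleIdx d ℓ aminus aplus m2plus a2minus a2plus :=
  ⟨1, le_rfl, aminus, 0, a2minus, le_rfl, ha', le_rfl, hm2, le_rfl, ha2, fun _ => N', fun _ => hN'⟩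

/-- the axis point `t·e_μ` lies in the cube `[0,S)^{d+1}` for `0 ≤ t < S`. [folklore] -/
theorem single_mem_cube {S : ℕ} (μ : Fin (d + 1)) {t : ℕ} (ht : t < S) :
    (Pi.single μ (t : ℤ) : Fin (d + 1) → ℤ) ∈ boxDom (fun _ : Fin (d + 1) => S) := by
  rw [mem_boxDom]
  intro j
  by_cases hj : j = μ
  · subst hj
    rw [Pi.single_eq_same]
    exact ⟨by exact_mod_cast t.zero_le, by exact_mod_cast ht⟩
  · rw [Pi.single_eq_of_ne hj]
    exact ⟨le_rfl, by exact_mod_cast lt_of_le_of_lt t.zero_le ht⟩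

/-- `t·e_μ + e_μ = (t+1)·e_μ` lies in the cube for `t + 1 < S`. [folklore] -/
theorem single_add_mem_cube {S : ℕ} (μ : Fin (d + 1)) {t : ℕ} (ht : t + 1 < S) :
    (Pi.single μ (t : ℤ) : Fin (d + 1) → ℤ) + Pi.single μ 1 ∈ boxDom (fun _ : Fin (d + 1) => S) := by
  rw [← Pi.single_add, show (t : ℤ) + 1 = ((t + 1 : ℕ) : ℤ) by push_cast; ring]
  exact single_mem_cube μ ht

/-- `(t+1)·e_μ = t·e_μ + e_μ` as cube points. [folklore] -/
theorem single_succ_eq {S : ℕ} (μ : Fin (d + 1)) {t : ℕ}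
    (h : (Pi.single μ ((t + 1 : ℕ) : ℤ) : Fin (d + 1) → ℤ) ∈ boxDom (fun _ : Fin (d + 1) => S))
    (h' : (Pi.single μ (t : ℤ) : Fin (d + 1) → ℤ) + Pi.single μ 1 ∈ boxDom (fun _ : Fin (d + 1) => S)) :
    (⟨Pi.single μ ((t + 1 : ℕ) : ℤ), h⟩ : ↥(boxDom (fun _ : Fin (d + 1) => S)))
      = ⟨(Pi.single μ (t : ℤ) : Fin (d + 1) → ℤ) + Pi.single μ 1, h'⟩ :=
  Subtype.ext (by push_cast; rw [Pi.single_add])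

/-- a neighbour of the corner `0` inside the box is a forward unit vector `e_μ`. [folklore] -/
theorem boxNbrs_zero {N : Fin (d + 1) → ℕ} (hN : ∀ i, 1 ≤ N i) {y : ↥(boxDom N)}
    (hy : y ∈ boxNbrs N ⟨0, zero_mem_boxDom hN⟩) : ∃ μ : Fin (d + 1), y.1 = Pi.single μ 1 := by
  simp only [boxNbrs, Finset.mem_filter, Finset.mem_univ, true_and] at hy
  obtain ⟨μ, h | h⟩ := mem_nbrs.1 hy
  · exact ⟨μ, by rw [h, zero_add]⟩
  · exfalso
    have hmem := (mem_boxDom.1 y.2 μ).1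
    rw [h] at hmem
    simp at hmem

/-- `e_μ` is a neighbour of the corner `0` inside the cube `[0,S)^{d+1}`, `S ≥ 2`. [folklore] -/
theorem single_mem_boxNbrs_zero {S : ℕ} (hS : ∀ i : Fin (d + 1), 1 ≤ (fun _ : Fin (d + 1) => S) i)
    (μ : Fin (d + 1)) (h : (Pi.single μ ((1 : ℕ) : ℤ) : Fin (d + 1) → ℤ) ∈ boxDom (fun _ : Fin (d + 1) => S)) :
    (⟨_, h⟩ : ↥(boxDom (fun _ : Fin (d + 1) => S))) ∈ boxNbrs (fun _ : Fin (d + 1) => S) ⟨0, zero_mem_boxDom hS⟩ := by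
  simp only [boxNbrs, Finset.mem_filter, Finset.mem_univ, true_and, mem_nbrs]
  exact ⟨μ, Or.inl (by push_cast; rw [zero_add])⟩

/-- `|t·e_μ|_∞ = |t|`. [folklore] -/
theorem supNorm_single (μ : Fin (d + 1)) (t : ℤ) : supNorm (Pi.single μ t : Fin (d + 1) → ℤ) = ((|t| : ℤ) : ℝ) := by
  apply le_antisymm
  · apply supNorm_le_of_forall
    intro i
    by_cases h : i = μ
    · subst h
      rw [Pi.single_eq_same]
    · rw [Pi.single_eq_of_ne h, abs_zero, Int.cast_zero]
      exact_mod_cast abs_nonneg t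
  · have h := abs_le_supNorm (Pi.single μ t : Fin (d + 1) → ℤ) μ
    rwa [Pi.single_eq_same] at h

/-- `t·e_μ ≠ 0` for `t ≥ 1`. [folklore] -/
theorem single_ne_zero (μ : Fin (d + 1)) {t : ℕ} (ht : 1 ≤ t) : (Pi.single μ (t : ℤ) : Fin (d + 1) → ℤ) ≠ 0 := by
  intro h
  have h' := congr_fun h μ
  rw [Pi.single_eq_same, Pi.zero_apply] at h'
  omega

/-- the axis profile of the corner column of the unit-mesh Green function (`m² = 0`): `t ↦ G(t·e_μ, 0)` for
`t·e_μ` in the box, `0` beyond. [folklore] -/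
def axisProfile (a : ℝ) (S : ℕ) (μ : Fin (d + 1))
    (h0 : (0 : Fin (d + 1) → ℤ) ∈ boxDom (fun _ : Fin (d + 1) => S)) (t : ℕ) : ℝ :=
  if h : (Pi.single μ (t : ℤ) : Fin (d + 1) → ℤ) ∈ boxDom (fun _ : Fin (d + 1) => S) then
    uG 0 a (fun _ : Fin (d + 1) => S) ⟨_, h⟩ ⟨0, h0⟩ else 0

/-- the axis profile at an in-box point is the Green entry. [folklore] -/
theorem axisProfile_of_mem (a : ℝ) {S : ℕ} (μ : Fin (d + 1))
    (h0 : (0 : Fin (d + 1) → ℤ) ∈ boxDom (fun _ : Fin (d + 1) => S)) {t : ℕ}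
    (h : (Pi.single μ (t : ℤ) : Fin (d + 1) → ℤ) ∈ boxDom (fun _ : Fin (d + 1) => S)) :
    axisProfile a S μ h0 t = uG 0 a (fun _ : Fin (d + 1) => S) ⟨_, h⟩ ⟨0, h0⟩ := by
  rw [axisProfile, dif_pos h]

/-- the axis profile is non-negative. [folklore] -/
theorem axisProfile_nonneg {a : ℝ} (ha : 0 < a) {S : ℕ} (hS : ∀ i : Fin (d + 1), 1 ≤ (fun _ : Fin (d + 1) => S) i)
    (μ : Fin (d + 1)) (h0 : (0 : Fin (d + 1) → ℤ) ∈ boxDom (fun _ : Fin (d + 1) => S)) (t : ℕ) :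
    0 ≤ axisProfile a S μ h0 t := by
  unfold axisProfile
  split_ifs with h
  · exact green_nonneg le_rfl ha hS _ _
  · exact le_rfl

/-- the axis profile is at most `1/a` (total mass). [folklore] -/
theorem axisProfile_le {a : ℝ} (ha : 0 < a) {S : ℕ} (hS : ∀ i : Fin (d + 1), 1 ≤ (fun _ : Fin (d + 1) => S) i)
    (μ : Fin (d + 1)) (h0 : (0 : Fin (d + 1) → ℤ) ∈ boxDom (fun _ : Fin (d + 1) => S)) (t : ℕ) :
    axisProfile a S μ h0 t ≤ 1 / (0 + a) := by
  have hs : 0 < 0 + a := by linarith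
  unfold axisProfile
  split_ifs with h
  · rw [le_div_iff₀ hs, mul_comm]
    exact green_le_one le_rfl ha hS _ _
  · positivity

/-- THE FAR SCALE `T(c₁, c, α) = ⌈(4c₁/c)^{1/(−α)}⌉ + 1`: `t^{−α} ≥ 4c₁/c` for `t ≥ T` (`α < 0`). [folklore] -/
def farT (c₁ c α : ℝ) : ℕ := ⌈(4 * c₁ / c) ^ (1 / (-α))⌉₊ + 1

/-- `T ≥ 1`. [folklore] -/
theorem one_le_farT (c₁ c α : ℝ) : 1 ≤ farT c₁ c α := Nat.le_add_left 1 _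

/-- the far scale beats the constant: `4c₁/c ≤ t^{−α}` for `t ≥ T`. [folklore] -/
theorem farT_spec {c₁ c α : ℝ} (hc₁ : 0 < c₁) (hc : 0 < c) (hα : α < 0) {t : ℕ} (ht : farT c₁ c α ≤ t) :
    4 * c₁ / c ≤ (t : ℝ) ^ (-α) := by
  have hβ : 0 < -α := by linarith
  have hq : 0 ≤ 4 * c₁ / c := by positivity
  have hy0 : 0 ≤ (4 * c₁ / c) ^ (1 / (-α)) := Real.rpow_nonneg hq _
  have hyt : (4 * c₁ / c) ^ (1 / (-α)) ≤ (t : ℝ) := by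
    have h1 := Nat.le_ceil ((4 * c₁ / c) ^ (1 / (-α)))
    have h2 : ((farT c₁ c α : ℕ) : ℝ) ≤ t := by exact_mod_cast ht
    unfold farT at h2
    push_cast at h2
    linarith
  calc 4 * c₁ / c = ((4 * c₁ / c) ^ (1 / (-α))) ^ (-α) := by
        rw [← Real.rpow_mul hq, one_div_mul_cancel hβ.ne', Real.rpow_one]
    _ ≤ (t : ℝ) ^ (-α) := Real.rpow_le_rpow hy0 hyt hβ.le

/-- THE NUMBER OF STEPS `K(s, c) = ⌈(1/s)/(c/2)⌉ + 1`: `K·(c/2) ≥ 1/s`. [folklore] -/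
def stepsK (s c : ℝ) : ℕ := ⌈(1 / s) / (c / 2)⌉₊ + 1

/-- `K ≥ 1`. [folklore] -/
theorem one_le_stepsK (s c : ℝ) : 1 ≤ stepsK s c := Nat.le_add_left 1 _

/-- `1/s ≤ K·(c/2)`. [folklore] -/
theorem stepsK_spec (s : ℝ) {c : ℝ} (hc : 0 < c) : 1 / s ≤ (stepsK s c : ℝ) * (c / 2) := by
  have h1 := Nat.le_ceil ((1 / s) / (c / 2))
  have h2 : (⌈(1 / s) / (c / 2)⌉₊ : ℝ) ≤ (stepsK s c : ℝ) := by
    unfold stepsK; push_cast; linarith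
  have h3 : (1 / s) / (c / 2) ≤ (stepsK s c : ℝ) := h1.trans h2
  rwa [div_le_iff₀ (by positivity)] at h3

/-- **THE TYPED (2.36) QUANTITY AT THE REFUTING CONFIGURATION** (member `cornerIdx`, direction `μ`, base point
`x = 0`, far point `x′ = t·e_μ`, unit point `y = 0`): `lhs236 α μ x x′ y = (1/t)^α·|(G(x′+e_μ,0) − G(x′,0)) −
(G(e_μ,0) − G(0,0))|` with `G` the unit-mesh Neumann box Green function `(−Δ^N_□ + a₋)⁻¹` of the cube (at `n = 1`
the block sum `Σ_{x″ ∈ B(y)}` is the single term `x″ = y = 0` and the complex entries are the real ones).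
[cite: Balaban1983RegularityDecay, p. 582 Lemma 2.4 (2.36), typed leaf `B4.Lemma24Printed` second conjunct read on
the zero-field box family `B4Lemma24ZeroBoxScale.zeroFieldScales`; dictionary] -/
theorem member_lhs236 (ha : 0 < aminus) (ha' : aminus ≤ aplus) (hm2 : 0 ≤ m2plus) (ha2 : a2minus ≤ a2plus)
    {N' : ℕ} (hN' : 1 ≤ N') (α : ℝ) (μ : Fin (d + 1)) {t : ℕ} (ht : 1 ≤ t)
    (h0F : (0 : Fin (d + 1) → ℤ) ∈ boxDom (fun _ : Fin (d + 1) => 1 * ((ℓ + 1) * N')))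
    (h0eF : (0 : Fin (d + 1) → ℤ) + Pi.single μ 1 ∈ boxDom (fun _ : Fin (d + 1) => 1 * ((ℓ + 1) * N')))
    (hpF : (Pi.single μ (t : ℤ) : Fin (d + 1) → ℤ) ∈ boxDom (fun _ : Fin (d + 1) => 1 * ((ℓ + 1) * N')))
    (hpeF : (Pi.single μ (t : ℤ) : Fin (d + 1) → ℤ) + Pi.single μ 1
      ∈ boxDom (fun _ : Fin (d + 1) => 1 * ((ℓ + 1) * N')))
    (h0U : (0 : Fin (d + 1) → ℤ) ∈ boxDom (fun _ : Fin (d + 1) => (ℓ + 1) * N')) :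
    (zeroFieldScales d ℓ aminus aplus m2plus a2minus a2plus (cornerIdx d ℓ ha' hm2 ha2 N' hN')).lhs236 α μ
        ⟨0, h0F⟩ ⟨Pi.single μ (t : ℤ), hpF⟩ ⟨0, h0U⟩
      = (1 / (t : ℝ)) ^ α *
        |(uG 0 aminus (fun _ : Fin (d + 1) => 1 * ((ℓ + 1) * N')) ⟨_, hpeF⟩ ⟨0, h0F⟩
            - uG 0 aminus (fun _ : Fin (d + 1) => 1 * ((ℓ + 1) * N')) ⟨_, hpF⟩ ⟨0, h0F⟩)
          - (uG 0 aminus (fun _ : Fin (d + 1) => 1 * ((ℓ + 1) * N')) ⟨_, h0eF⟩ ⟨0, h0F⟩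
            - uG 0 aminus (fun _ : Fin (d + 1) => 1 * ((ℓ + 1) * N')) ⟨0, h0F⟩ ⟨0, h0F⟩)| := by
  have hg : (0 : Fin (d + 1) → ℤ) + Pi.single μ 1 ∈ boxDom (fun _ : Fin (d + 1) => 1 * ((ℓ + 1) * N')) ∧
      (Pi.single μ (t : ℤ) : Fin (d + 1) → ℤ) + Pi.single μ 1 ∈ boxDom (fun _ : Fin (d + 1) => 1 * ((ℓ + 1) * N')) ∧
      (Pi.single μ (t : ℤ) : Fin (d + 1) → ℤ) ≠ 0 := ⟨h0eF, hpeF, single_ne_zero μ ht⟩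
  have hM : ∀ i : Fin (d + 1), 1 ≤ (fun _ : Fin (d + 1) => (ℓ + 1) * N') i :=
    fun _ => le_trans hN' (Nat.le_mul_of_pos_left _ (Nat.succ_pos ℓ))
  dsimp only [zeroFieldScales, cornerIdx, ScaleIdx.M]
  rw [dif_pos hg]
  rw [Finset.sum_eq_single (⟨0, h0F⟩ : ↥(boxDom (fun _ : Fin (d + 1) => 1 * ((ℓ + 1) * N'))))]
  · rw [if_pos (blk_one 0), boxOp_inv_eq_map le_rfl ha le_rfl hM, boxOpR_one]
    simp only [Matrix.map_apply, Nat.cast_one, one_mul, sub_zero]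
    rw [← Complex.ofReal_sub, ← Complex.ofReal_sub, ← Complex.ofReal_sub, Complex.norm_real, Real.norm_eq_abs,
      supNorm_single, Nat.abs_cast, Int.cast_natCast]
  · intro b _ hb
    rw [if_neg]
    rw [blk_one]
    exact fun h => hb (Subtype.ext h)
  · exact fun h => absurd (Finset.mem_univ _) h

/-- at the refuting configuration the decay distance of (2.36) vanishes: `min(|x − y|, |x′ − y|) = |0 − 0| = 0`.
[folklore] -/
theorem member_dist2F (ha' : aminus ≤ aplus) (hm2 : 0 ≤ m2plus) (ha2 : a2minus ≤ a2plus)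
    {N' : ℕ} (hN' : 1 ≤ N') (μ : Fin (d + 1)) (t : ℕ)
    (h0F : (0 : Fin (d + 1) → ℤ) ∈ boxDom (fun _ : Fin (d + 1) => 1 * ((ℓ + 1) * N')))
    (hpF : (Pi.single μ (t : ℤ) : Fin (d + 1) → ℤ) ∈ boxDom (fun _ : Fin (d + 1) => 1 * ((ℓ + 1) * N')))
    (h0U : (0 : Fin (d + 1) → ℤ) ∈ boxDom (fun _ : Fin (d + 1) => (ℓ + 1) * N')) :
    (zeroFieldScales d ℓ aminus aplus m2plus a2minus a2plus (cornerIdx d ℓ ha' hm2 ha2 N' hN')).dist2F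
        ⟨0, h0F⟩ ⟨Pi.single μ (t : ℤ), hpF⟩ ⟨0, h0U⟩ = 0 := by
  dsimp only [zeroFieldScales, cornerIdx, ScaleIdx.M]
  have h1 : fdist 1 (0 : Fin (d + 1) → ℤ) 0 = 0 := by
    have e : (0 : Fin (d + 1) → ℤ) - (fun i => ((1 : ℕ) : ℤ) * (0 : Fin (d + 1) → ℤ) i) = 0 := by
      funext i; simp
    unfold fdist
    rw [e, supNorm_zero']
    simp
  rw [h1]
  exact min_eq_left (fdist_nonneg _ _ _)

end Member

/-! ## §4  The refutation: the typed (2.36) clause fails for every `α < 0` on the zero-field box family, hence so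
does the typed leaf `B4.Lemma24Printed`; with node 21 the Hölder-range dichotomy -/

section Refutation

variable {ℓ : ℕ} {aminus aplus m2plus a2minus a2plus : ℝ}

/-- **THE TYPED (2.36) CLAUSE FAILS FOR EVERY `α < 0`** on the zero-field box family `zeroFieldScales` (every window
with `a₋ > 0`, every `L = ℓ + 1 ≥ 1`, every dimension): for every decay rate `δ₀ ∈ ℝ` and every constant `c₁ > 0`
some member violates `lhs236 ≤ c₁·exp(−δ₀·dist2F)`.  The member is the unit-mesh cube (`j = 0`, `m² = 0`,
`a_j = a₋`) of `N′ ≥ T + K + 1` `L`-blocks per side, the configuration `x = y = 0` (a corner; decay distance `0`,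
so `δ₀` plays no role) and `x′ = t·e_μ` with `T ≤ t < T + K`: the bracket `|(G(x′+e_μ,0) − G(x′,0)) − (G(e_μ,0) −
G(0,0))| ≥ c_*/2` (box-independent corner gap `G(0,0) − G(e_μ,0) ≥ c_*` of §1 in a suitable direction `μ`, and a
pigeonholed far step `G((t+1)e_μ,0) − G(te_μ,0) ≥ −c_*/2` of §2, the column being bounded by `1/a₋`), while the
weight `(1/t)^α = t^{−α} ≥ T^{−α} ≥ 4c₁/c_*` GROWS without bound — so the left side is `≥ 2c₁ > c₁ =` the right side.
[cite: Balaban1983RegularityDecay, p. 582 Lemma 2.4 (2.36) «for α < 1» — the literal range read with α < 0, case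
A = 0 on boxes at mesh L⁰η = 1; typed clause `B4Lemma24ZeroBoxScale.Bound236` = the second conjunct of
`B4.Lemma24Printed` at one α] -/
theorem not_bound236_zeroFieldScales (d ℓ : ℕ) {aminus aplus m2plus a2minus a2plus : ℝ} (ha : 0 < aminus)
    (ha' : aminus ≤ aplus) (hm2 : 0 ≤ m2plus) (ha2 : a2minus ≤ a2plus) {α : ℝ} (hα : α < 0) (δ₀ : ℝ) :
    ¬ Bound236 (zeroFieldScales d ℓ aminus aplus m2plus a2minus a2plus) δ₀ α := by
  classical
  rintro ⟨c₁, hc₁, hB⟩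
  have hs : (0 : ℝ) < 0 + aminus := by linarith
  obtain ⟨c, hc_def⟩ : ∃ c : ℝ, c = cstar d (0 + aminus) := ⟨_, rfl⟩
  have hc : 0 < c := hc_def ▸ cstar_pos d hs
  obtain ⟨T, hT1, hTspec⟩ : ∃ T : ℕ, 1 ≤ T ∧ ∀ t : ℕ, T ≤ t → 4 * c₁ / c ≤ (t : ℝ) ^ (-α) :=
    ⟨farT c₁ c α, one_le_farT _ _ _, fun t ht => farT_spec hc₁ hc hα ht⟩
  obtain ⟨K, hK1, hKc⟩ : ∃ K : ℕ, 1 ≤ K ∧ 1 / (0 + aminus) ≤ (K : ℝ) * (c / 2) :=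
    ⟨stepsK (0 + aminus) c, one_le_stepsK _ _, stepsK_spec _ hc⟩
  obtain ⟨N', hN'⟩ : ∃ N' : ℕ, T + K + 1 ≤ N' := ⟨_, le_rfl⟩
  have hN'1 : 1 ≤ N' := by omega
  -- the fine cube `[0, L·N′)^{d+1}` (mesh 1) and the unit cube `[0, L·N′)^{d+1}`
  have hSN : N' ≤ 1 * ((ℓ + 1) * N') := by
    rw [one_mul]
    exact Nat.le_mul_of_pos_left _ (Nat.succ_pos ℓ)
  have hS1 : ∀ j : Fin (d + 1), 1 ≤ (fun _ : Fin (d + 1) => 1 * ((ℓ + 1) * N')) j := fun _ => le_trans hN'1 hSN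
  have hU1 : ∀ j : Fin (d + 1), 1 ≤ (fun _ : Fin (d + 1) => (ℓ + 1) * N') j :=
    fun _ => le_trans hN'1 (Nat.le_mul_of_pos_left _ (Nat.succ_pos ℓ))
  have h0F : (0 : Fin (d + 1) → ℤ) ∈ boxDom (fun _ : Fin (d + 1) => 1 * ((ℓ + 1) * N')) := zero_mem_boxDom hS1
  have h0U : (0 : Fin (d + 1) → ℤ) ∈ boxDom (fun _ : Fin (d + 1) => (ℓ + 1) * N') := zero_mem_boxDom hU1
  -- the corner `0` has the in-box neighbour `e_0`; the corner gap in some direction `μ`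
  have h1S : 1 < 1 * ((ℓ + 1) * N') := by omega
  have he0 : (Pi.single (0 : Fin (d + 1)) ((1 : ℕ) : ℤ) : Fin (d + 1) → ℤ)
      ∈ boxDom (fun _ : Fin (d + 1) => 1 * ((ℓ + 1) * N')) := single_mem_cube 0 h1S
  obtain ⟨y, hy, hgap⟩ := green_gap (le_refl (0 : ℝ)) ha hS1
    (⟨0, h0F⟩ : ↥(boxDom (fun _ : Fin (d + 1) => 1 * ((ℓ + 1) * N')))) ⟨_, single_mem_boxNbrs_zero hS1 0 he0⟩
  obtain ⟨μ, hμ⟩ := boxNbrs_zero hS1 hy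
  have heF : (Pi.single μ ((1 : ℕ) : ℤ) : Fin (d + 1) → ℤ) ∈ boxDom (fun _ : Fin (d + 1) => 1 * ((ℓ + 1) * N')) :=
    single_mem_cube μ h1S
  have h0eF : (0 : Fin (d + 1) → ℤ) + Pi.single μ 1 ∈ boxDom (fun _ : Fin (d + 1) => 1 * ((ℓ + 1) * N')) := by
    rw [zero_add]
    exact_mod_cast heF
  have hy' : y = ⟨(0 : Fin (d + 1) → ℤ) + Pi.single μ 1, h0eF⟩ := Subtype.ext (by rw [hμ]; exact (zero_add _).symm)
  rw [hy', ← hc_def] at hgap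
  -- the pigeonholed far step along the axis `μ`
  obtain ⟨t, hTt, htK, hstep⟩ :=
    exists_step_ge (axisProfile_nonneg ha hS1 μ h0F) (axisProfile_le ha hS1 μ h0F) T K hK1 hKc
  have ht1 : 1 ≤ t := le_trans hT1 hTt
  have htS : t < 1 * ((ℓ + 1) * N') := by omega
  have ht1S : t + 1 < 1 * ((ℓ + 1) * N') := by omega
  have hpF := single_mem_cube (S := 1 * ((ℓ + 1) * N')) μ htS
  have hpeF := single_add_mem_cube (S := 1 * ((ℓ + 1) * N')) μ ht1S
  have hp1F := single_mem_cube (S := 1 * ((ℓ + 1) * N')) μ ht1S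
  rw [axisProfile_of_mem aminus μ h0F hp1F, axisProfile_of_mem aminus μ h0F hpF, single_succ_eq μ hp1F hpeF]
    at hstep
  -- the typed (2.36) instance at `(μ, x = 0, x′ = t·e_μ, y = 0)` of the member
  have key := hB (cornerIdx d ℓ ha' hm2 ha2 N' hN'1) trivial μ ⟨0, h0F⟩ ⟨Pi.single μ (t : ℤ), hpF⟩ ⟨0, h0U⟩
  rw [member_lhs236 ha ha' hm2 ha2 hN'1 α μ ht1 h0F h0eF hpF hpeF h0U,
    member_dist2F ha' hm2 ha2 hN'1 μ t h0F hpF h0U, mul_zero, neg_zero, Real.exp_zero, mul_one] at key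
  -- weight `≥ 4c₁/c_*`, bracket `≥ c_*/2`: left side `≥ 2c₁ > c₁` = right side
  have ht0 : (0 : ℝ) ≤ t := Nat.cast_nonneg t
  have hw : 4 * c₁ / c ≤ (1 / (t : ℝ)) ^ α := by
    rw [one_div, Real.inv_rpow ht0, ← Real.rpow_neg ht0]
    exact hTspec t hTt
  have hD : c / 2 ≤ |(uG 0 aminus (fun _ : Fin (d + 1) => 1 * ((ℓ + 1) * N')) ⟨_, hpeF⟩ ⟨0, h0F⟩
        - uG 0 aminus (fun _ : Fin (d + 1) => 1 * ((ℓ + 1) * N')) ⟨_, hpF⟩ ⟨0, h0F⟩)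
      - (uG 0 aminus (fun _ : Fin (d + 1) => 1 * ((ℓ + 1) * N')) ⟨_, h0eF⟩ ⟨0, h0F⟩
        - uG 0 aminus (fun _ : Fin (d + 1) => 1 * ((ℓ + 1) * N')) ⟨0, h0F⟩ ⟨0, h0F⟩)| :=
    le_trans (by linarith) (le_abs_self _)
  have hprod := mul_le_mul hw hD (by positivity) (le_trans (by positivity) hw)
  have e : 4 * c₁ / c * (c / 2) = 2 * c₁ := by
    field_simp
    ring
  rw [e] at hprod
  linarith

/-- **THE TYPED LEAF `B4.Lemma24Printed` FAILS ON THE ZERO-FIELD BOX FAMILY** (every window with `a₋ > 0`, every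
`L ≥ 1`, every dimension): its second conjunct quantifies `∀ α : ℝ, α < 1 → …`, and the instance `α = −1` has no
constant `c₁` at any decay rate `δ₀` (`not_bound236_zeroFieldScales`).  [cite: Balaban1983RegularityDecay, p. 582
Lemma 2.4 (2.35)–(2.37); typed leaf `B4.Lemma24Printed` (B4.lean), read through `lemma24Printed_iff` (`Iff.rfl`)] -/
theorem not_lemma24Printed_zeroFieldScales (d ℓ : ℕ) {aminus aplus m2plus a2minus a2plus : ℝ} (ha : 0 < aminus)
    (ha' : aminus ≤ aplus) (hm2 : 0 ≤ m2plus) (ha2 : a2minus ≤ a2plus) :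
    ¬ B4.Lemma24Printed (zeroFieldScales d ℓ aminus aplus m2plus a2minus a2plus) := by
  rw [lemma24Printed_iff]
  rintro ⟨c₀, δ₀, -, -, -, h236⟩
  exact not_bound236_zeroFieldScales d ℓ ha ha' hm2 ha2 (show (-1 : ℝ) < 0 by norm_num) δ₀
    (h236 (-1) (by norm_num))

/-- **THE HÖLDER-RANGE DICHOTOMY FOR LEMMA 2.4 ON THE ZERO-FIELD BOX FAMILY**: the typed leaf with the Hölder
exponent restricted to `0 ≤ α < 1` HOLDS (node 21, `B4Lemma24ZeroBoxScale.lemma24PrintedNN_zeroFieldScales`) AND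
the literal typed leaf («α < 1» with no lower bound) FAILS — for every window `0 < a₋ ≤ a₊`, `m²₊ ≥ 0`,
`0 < a₂₋ ≤ a₂₊`, every `L ≥ 2`, every dimension.  [cite: Balaban1983RegularityDecay, p. 582 Lemma 2.4
(2.35)–(2.37), p. 577 (2.14) (the Hölder norm; no lower bound for `α` is printed, `0 ≤ α` is tacit — pp. 582/585);
typed leaf `B4.Lemma24Printed` vs its restriction `Lemma24PrintedNN`] -/
theorem holderRange_dichotomy_zeroFieldScales (d : ℕ) {ℓ : ℕ} (hℓ : 1 ≤ ℓ)
    {aminus aplus m2plus a2minus a2plus : ℝ} (ha : 0 < aminus) (ha' : aminus ≤ aplus) (hm2 : 0 ≤ m2plus)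
    (ha2 : 0 < a2minus) (ha2' : a2minus ≤ a2plus) :
    Lemma24PrintedNN (zeroFieldScales d ℓ aminus aplus m2plus a2minus a2plus) ∧
      ¬ B4.Lemma24Printed (zeroFieldScales d ℓ aminus aplus m2plus a2minus a2plus) :=
  ⟨lemma24PrintedNN_zeroFieldScales d ℓ hℓ ha ha2, not_lemma24Printed_zeroFieldScales d ℓ ha ha' hm2 ha2'⟩

/-- in particular the converse of node 21's restriction `Lemma24Printed → Lemma24PrintedNN` is FALSE on this family:
the restricted leaf does not give back the literal one. [folklore] -/
theorem not_lemma24Printed_of_NN (d : ℕ) {ℓ : ℕ} (hℓ : 1 ≤ ℓ)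
    {aminus aplus m2plus a2minus a2plus : ℝ} (ha : 0 < aminus) (ha' : aminus ≤ aplus) (hm2 : 0 ≤ m2plus)
    (ha2 : 0 < a2minus) (ha2' : a2minus ≤ a2plus) :
    ¬ (Lemma24PrintedNN (zeroFieldScales d ℓ aminus aplus m2plus a2minus a2plus) →
        B4.Lemma24Printed (zeroFieldScales d ℓ aminus aplus m2plus a2minus a2plus)) :=
  fun h => not_lemma24Printed_zeroFieldScales d ℓ ha ha' hm2 ha2' (h (lemma24PrintedNN_zeroFieldScales d ℓ hℓ ha ha2))

end Refutation

/-! ## §5  Non-vacuity: the concrete family of node 21 (`d + 1 = 4`, `L = 2`, window `[1/2,2] × [0,1] × [1/2,2]`) -/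

/-- the typed leaf fails on node 21's concrete zero-field box family (which is inhabited, `B4Lemma24ZeroBoxScale.idx0`,
and on which the `0 ≤ α < 1` restriction holds). [folklore] -/
example : ¬ B4.Lemma24Printed (zeroFieldScales 3 1 (1 / 2) 2 1 (1 / 2) 2) :=
  not_lemma24Printed_zeroFieldScales 3 1 (by norm_num) (by norm_num) (by norm_num) (by norm_num)

/-- … while its `0 ≤ α < 1` restriction holds there (node 21). [folklore] -/
example : Lemma24PrintedNN (zeroFieldScales 3 1 (1 / 2) 2 1 (1 / 2) 2) ∧
    ¬ B4.Lemma24Printed (zeroFieldScales 3 1 (1 / 2) 2 1 (1 / 2) 2) :=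
  holderRange_dichotomy_zeroFieldScales 3 le_rfl (by norm_num) (by norm_num) (by norm_num) (by norm_num) (by norm_num)

/-- the index window of the concrete family is inhabited (node 21's `idx0`), so the refuted leaf is not a statement
about an empty family. [folklore] -/
example : Nonempty (ScaleIdx 3 1 (1 / 2) 2 1 (1 / 2) 2) := ⟨idx0⟩

/-- the (2.36) clause at `α = −1/2`, `δ₀ = 0` already fails on the concrete family. [folklore] -/
example : ¬ Bound236 (zeroFieldScales 3 1 (1 / 2) 2 1 (1 / 2) 2) 0 (-1 / 2) :=
  not_bound236_zeroFieldScales 3 1 (by norm_num) (by norm_num) (by norm_num) (by norm_num) (by norm_num) 0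

end

end Literature.MathematicalPhysics.QuantumFieldTheory.Balaban1983to89.B4Lemma24ZeroBoxAlphaNeg
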